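import Mathlib.Tactic

/-!
# Window cells, all `m`: the arithmetic of LEMMA L (the last Harder–Narasimhan piece)

HONEST FRAMING. Lean index of the computation cell `pub-hsemireg` (W4 widening, representation-first
seat w4-rep-2, gen 16; doc of record `widen/W4/w4rep2/g16/theory/LADDER-ALLM-w4rep2g16.md` §7).
Elementary integer arithmetic quantified over all `m`; no abelian surface or sheaf is formalised, and
nothing in this file says HC, HC_CM or HC_AV is proved. No `sorry`, no axiom beyond the standard three,
no named fact, no `def`.

CONTEXT (informal). In a window cell `(n; m, 3m)` (`m` odd, `t = m - 4`) let a Harder–Narasimhan type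
of the cokernel have all slopes `> 2` ("residual") and let `G = (r, u)` be its LAST piece (rank `r`,
`c₁ = m u`). Then `2r < m u` (slope `> 2`), `t u < 2 r` (the last slope is below the mean `2m/t`), the
transport congruence FM-DIV reads `2 r = t u + 3 m w` with `w ≥ 1` (coprime cell; `2 r = t u + m w` in a
principal cell, `t = 3τ`, `m = 3τ + 4`), `u ≤ 2t - 1` (resp. `u ≤ 2τ - 1`) and `r ≤ t² - 1`. The one
A-side certificate `Â₂` with LEMMA SPLIT gives `ch₂(G) ≥ 12(m u - r)`, the Bogomolov inequality gives
`r · ch₂(G) ≤ 3 m² u²`, and LEMMA CHI gives `ch₂(G) = 3 m² j` (resp. `m² j`) for an integer `j`.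
Below: these are contradictory for every odd `m ≥ 9` (coprime form) and every odd `τ ≥ 1` (principal
form). So no residual type exists, uniformly in `m` — the window-cell ladder needs no per-cell
enumeration. A third theorem records the principal-cell form of LEMMA GAP-2's arithmetic (the coprime
form is w4-lat-2's `WindowCellGapTwo.gap_two_core`), so that with it every arithmetic step of THEOREM U
(§7 of the note) is kernel-checked for all `m`.
-/

namespace Summit.Ventures.HSemireg.WindowCellLastPiece

/-- LEMMA L, coprime form, arithmetic core, for ALL odd `m ≥ 9`: the last piece `(r, u)` with
`2r = (m-4)u + 3mw`, `w ≥ 1`, `2r < mu`, `u ≤ 2(m-4) - 1`, `r ≤ (m-4)² - 1`, the pinned lower bound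
`12(mu - r) ≤ 3m²j` and the Bogomolov upper bound `jr ≤ u²` cannot coexist. -/
theorem last_piece_coprime (m u r j w : ℤ) (hm : 9 ≤ m) (hodd : Odd m) (hw : 1 ≤ w)
    (h2r : 2 * r = (m - 4) * u + 3 * m * w) (hslope : 2 * r < m * u)
    (hu : u ≤ 2 * (m - 4) - 1) (hr : r ≤ (m - 4) ^ 2 - 1)
    (hL : 12 * (m * u - r) ≤ 3 * m ^ 2 * j) (hU : j * r ≤ u ^ 2) : False := by
  obtain ⟨a, ha⟩ := hodd
  have hm0 : 0 < m := by linarith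
  have hu0 : 0 < u := by nlinarith
  have hr0 : 0 < r := by nlinarith
  -- 4u > 3mw (slope > 2), hence j ≥ 2 and w = 1
  have h4u : 3 * m * w < 4 * u := by linarith
  -- j ≤ 3 : u² ≤ u(2t-1) < 2tu + 6m ≤ 4r
  have hj3 : j ≤ 3 := by
    by_contra hcon
    have hj4 : 4 ≤ j := by omega
    have h4r : 4 * r ≤ j * r := by nlinarith
    nlinarith
  -- j ≥ 2 : 3m²j ≥ 12(mu-r) = 6u(m+4) - 18mw > (9/2)m²w
  have hj2 : 2 ≤ j := by
    by_contra hcon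
    have hj1 : j ≤ 1 := by omega
    have : 3 * m ^ 2 * j ≤ 3 * m ^ 2 := by nlinarith
    nlinarith
  have hw1 : w = 1 := by
    by_contra hcon
    have hw2 : 2 ≤ w := by omega
    have : 3 * m ^ 2 * j ≤ 9 * m ^ 2 := by nlinarith
    nlinarith
  subst hw1
  interval_cases j
  · -- j = 2 : (L) gives u ≤ m - 1, then (U) 2r = (m-4)u + 3m ≤ u² is impossible
    have hum : u ≤ m - 1 := by
      by_contra hcon
      have hmu : m ≤ u := by omega
      have := mul_le_mul_of_nonneg_right hmu (show (0:ℤ) ≤ m + 4 by linarith)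
      nlinarith
    by_cases hut : u ≤ m - 4
    · nlinarith [mul_nonneg (show (0:ℤ) ≤ u by linarith) (show (0:ℤ) ≤ m - 4 - u by linarith)]
    · push Not at hut
      nlinarith [mul_le_mul_of_nonneg_left hum (show (0:ℤ) ≤ u by linarith)]
  · -- j = 3 : (L) gives 2u(m+4) ≤ 3m² + 6m, (U) gives 3((m-4)u + 3m) ≤ 2u²
    have hL' : 2 * u * (m + 4) ≤ 3 * m ^ 2 + 6 * m := by nlinarith
    have hU' : 3 * ((m - 4) * u + 3 * m) ≤ 2 * u ^ 2 := by nlinarith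
    by_cases hbig : 21 ≤ m
    · -- m ≥ 21 : 2u ≤ 3m - 7 (parity), then 2u² - 3(m-4)u - 9m < 0
      have h2u : 2 * u ≤ 3 * m - 7 := by
        by_contra hcon
        have h35 : 3 * m - 5 ≤ 2 * u := by omega
        have := mul_le_mul_of_nonneg_right h35 (show (0:ℤ) ≤ m + 4 by linarith)
        nlinarith
      nlinarith [mul_nonneg (show (0:ℤ) ≤ u by linarith) (show (0:ℤ) ≤ 3 * m - 7 - 2 * u by linarith)]
    · -- 9 ≤ m ≤ 20 odd : finitely many cases (u is bounded by (L))
      push Not at hbig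
      have h13 : 2 * u * 13 ≤ 2 * u * (m + 4) :=
        mul_le_mul_of_nonneg_left (by linarith) (by linarith)
      have hub : u ≤ 51 := by nlinarith
      have hlb : 1 ≤ u := by linarith
      interval_cases m <;> interval_cases u <;> omega

/-- LEMMA L, principal form (`m = 3τ + 4`, `t = 3τ`, `τ ≥ 1`; modulus `m²`): the last piece `(r, u)`
with `2r = 3τu + mw`, `w ≥ 1`, `2r < mu`, `u ≤ 2τ - 1` (`τ` odd, as `m` is odd), the pinned lower bound `12(mu - r) ≤ m²j`
and the Bogomolov upper bound `jr ≤ 3u²` cannot coexist. -/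
theorem last_piece_principal (τ u r j w : ℤ) (hτ : 1 ≤ τ) (hodd : Odd τ) (hw : 1 ≤ w)
    (h2r : 2 * r = 3 * τ * u + (3 * τ + 4) * w) (hslope : 2 * r < (3 * τ + 4) * u)
    (hu : u ≤ 2 * τ - 1)
    (hL : 12 * ((3 * τ + 4) * u - r) ≤ (3 * τ + 4) ^ 2 * j) (hU : j * r ≤ 3 * u ^ 2) : False := by
  have hu0 : 0 < u := by nlinarith
  have hr0 : 0 < r := by nlinarith
  have h4u : (3 * τ + 4) * w < 4 * u := by linarith
  -- j ≤ 3 : jr ≤ 3u² < 3u·2τ = 2·(3τu) < 4r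
  have hj3 : j ≤ 3 := by
    by_contra hcon
    have hj4 : 4 ≤ j := by omega
    have h4r : 4 * r ≤ j * r := by nlinarith
    nlinarith
  have hj2 : 2 ≤ j := by
    by_contra hcon
    have hj1 : j ≤ 1 := by omega
    have : (3 * τ + 4) ^ 2 * j ≤ (3 * τ + 4) ^ 2 := by nlinarith
    nlinarith
  have hw1 : w = 1 := by
    by_contra hcon
    have hw2 : 2 ≤ w := by omega
    have : (3 * τ + 4) ^ 2 * j ≤ 3 * (3 * τ + 4) ^ 2 := by nlinarith
    nlinarith
  subst hw1
  interval_cases j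
  · -- j = 2 : (L) ⇒ 3u ≤ m - 1 = 3τ + 3 ⇒ u ≤ τ + 1 ; (U) ⇒ 3τu + m ≤ 3u², impossible
    have hut : u ≤ τ + 1 := by
      by_contra hcon
      have h2 : τ + 2 ≤ u := by omega
      have := mul_le_mul_of_nonneg_right h2 (show (0:ℤ) ≤ 3 * τ + 8 by linarith)
      nlinarith
    by_cases h1 : u ≤ τ
    · nlinarith [mul_nonneg (show (0:ℤ) ≤ u by linarith) (show (0:ℤ) ≤ τ - u by linarith)]
    · push Not at h1
      have hu1 : u = τ + 1 := by omega
      subst hu1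
      nlinarith
  · -- j = 3 : (L) ⇒ 2u ≤ 3τ + 2, parity (τ odd) ⇒ 2u ≤ 3τ + 1 ; (U) ⇒ 3(3τu + m) ≤ 6u², impossible
    obtain ⟨b, hb⟩ := hodd
    have h2u' : 2 * u ≤ 3 * τ + 2 := by
      by_contra hcon
      have h3 : 3 * τ + 3 ≤ 2 * u := by omega
      have := mul_le_mul_of_nonneg_right h3 (show (0:ℤ) ≤ 3 * τ + 8 by linarith)
      nlinarith
    have h2u : 2 * u ≤ 3 * τ + 1 := by omega
    nlinarith [mul_nonneg (show (0:ℤ) ≤ u by linarith) (show (0:ℤ) ≤ 3 * τ + 1 - 2 * u by linarith)]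

/-- LEMMA GAP-2, principal form, arithmetic core (the coprime form is w4-lat-2's
`WindowCellGapTwo.gap_two_core`): in a principal cell (`m = 3τ + 4`, `t = 3τ`, `τ` odd) a split across
slope 2 with top part `F` of rank `r` and `c₁ = m U` has `0 < 2r < mU`, `U ≤ 2τ - 1`, the pinned Euler
characteristic `m² ∣ 16 + 3(mU - r)` (from `χ(F) = 64 + 12(mU - r) ∈ m²ℤ`) and the transport congruence
`m ∣ 2r - tU`; these cannot hold together. -/
theorem gap_two_principal (τ U r : ℤ) (hτ : 1 ≤ τ) (hodd : Odd τ) (hr : 0 < r)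
    (h2r : 2 * r < (3 * τ + 4) * U) (hU : U ≤ 2 * τ - 1)
    (hsq : (3 * τ + 4) ^ 2 ∣ 16 + 3 * ((3 * τ + 4) * U - r))
    (hdiv : (3 * τ + 4) ∣ 2 * r - 3 * τ * U) : False := by
  obtain ⟨k, hk⟩ := hsq
  obtain ⟨b, hb⟩ := hodd
  have hU1 : 1 ≤ U := by nlinarith
  -- the multiple is m² itself: 0 < 16 + 3(mU - r) < 2m²
  have hk1 : 1 ≤ k := by
    by_contra hcon
    have hk0 : k ≤ 0 := by omega
    have : (3 * τ + 4) ^ 2 * k ≤ 0 := by nlinarith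
    nlinarith
  have hk2 : k ≤ 1 := by
    by_contra hcon
    have hk3 : 2 ≤ k := by omega
    have h2 : 2 * (3 * τ + 4) ^ 2 ≤ (3 * τ + 4) ^ 2 * k := by nlinarith
    have hmU : (3 * τ + 4) * U ≤ (3 * τ + 4) * (2 * τ - 1) := by nlinarith
    nlinarith
  have hk' : k = 1 := le_antisymm hk2 hk1
  subst hk'
  -- so 3r = 3mU - m² + 16, and FM-DIV_P becomes m ∣ 4(3U + 8)
  have h3r : 3 * r = 3 * (3 * τ + 4) * U - (3 * τ + 4) ^ 2 + 16 := by linarith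
  have h4 : (3 * τ + 4) ∣ 4 * (3 * U + 8) := by
    obtain ⟨c, hc⟩ := hdiv
    refine ⟨3 * c - 3 * U + 2 * (3 * τ + 4), ?_⟩
    linear_combination (3 : ℤ) * hc - 2 * h3r
  -- m = 3τ + 4 = 2(3b + 3) + 1 is odd: 4·(3b+4)² ≡ 1 (mod m), so m ∣ 3U + 8
  have hU8 : (3 * τ + 4) ∣ 3 * U + 8 := by
    have key : 3 * U + 8 = 4 * (3 * U + 8) * (3 * b + 4) ^ 2 - (3 * τ + 4) * ((3 * U + 8) * (3 * τ + 6)) := by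
      rw [hb]; ring
    rw [key]
    exact dvd_sub (dvd_mul_of_dvd_left h4 _) (dvd_mul_right _ _)
  obtain ⟨j, hj⟩ := hU8
  -- 11 ≤ 3U + 8 ≤ 2m - 3 forces 3U + 8 = m = 3τ + 4, i.e. 3U = 3τ - 4: impossible
  have hj1 : 1 ≤ j := by nlinarith
  have hj2 : j ≤ 1 := by nlinarith
  have hj' : j = 1 := le_antisymm hj2 hj1
  subst hj'
  omega

end Summit.Ventures.HSemireg.WindowCellLastPiece
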